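import Summits.AtomisticToContinuum.Crystallization.Theorems.PhononSlackCertificatesNearFieldConvexityOfEnergySplit

/-!
# Skeleton v24 — line `Sketch` for the crux `PhononSlackCertificates.NearFieldConvexity`
(item stmt-AtomisticToContinuum-13958; continuation leads -c1 / -c2 / -c3 / -c4 / -c5)

v24 (lead c5, 2026-08-17 ~19:00Z): the COMPOSITION IS IN THE TREE.  `nearFieldConvexity_of_energySplit` (p172837,
`Theorems/…NearFieldConvexityOfEnergySplit.lean`) proves (I_flat) → (II_band) → crux with the two registered texts verbatim, and
`nearFieldConvexity_of_energySplit_at` the pointwise format (I_flat at ε₁) → (II_band at ε₁) → crux (intended ε₁ = 1/100; the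
pointwise statements give back the banded texts, `flatnessPaid_band_of_at` / `roughSitesPaid_band_of_at`, p173104).  The skeleton is
therefore reduced to the two registered stubs and a one-line composition; both stubs are crux-sized and handed back for PROMOTION
(`Lines/Sketch-PROMOTE.md`: ITEM B = I_flat@1/100, ITEM C = II_band@1/100, ITEM A = shared harmonic tube coercivity TC@1/30).
Everything else of the line (chart N1 closed, coarse regime η ≥ 2/5 unconditional p171050, all energy-side reductions) is landed and
imported through the assembly file.  Sorries: `stub_flatnessPaid` (I_flat), `stub_roughSitesPaid` (II_band).

v23 (lead c4, ~17:45Z): the coarse crux `stub_nearFieldConvexityCoarse` (every η ≥ 2/5, unconditional) is LANDED (p171050);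
the perturbative stub is pushed one step further into the twin crux's vocabulary: (I_sq) follows (W4, p171255
`stub_thresholdSqOfFlatness`) from the new registered stub `stub_flatnessPaid` (I_flat): affine flatness witnesses `(s_i, G_i, ν_i)`
(the twin's B″ clauses verbatim) plus box cells `(A_i, a_i, h_i)` `r_i`-close to `G_i` on the unit sites of norm ≤ 3, at the radius-8
interior sites of an ε₁-good set, with `Σ (2400 ν_i² + 800 r_i²) ≤ K·[E_self − |Ω|e*] + C·#∂₄Ω` (chart-free: charts are theorems now,
`stub_chartsOfGood` p171281).  (II_band) keeps its two landed entry formats (Chebyshev p171203, pointwise certificate p171209).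
Sorries: `stub_flatnessPaid` (I_flat), `stub_roughSitesPaid` (II_band).

v22 (lead c4, 2026-08-17 ~17:00Z): THE CHART IS CLOSED.  The twin crux's lead landed `stub_labelledPlacement` in full
(`NashClassCertificatesNashNearField.stub_labelledPlacement`, p170130, 16:05Z; certificate tree `TwoShellChartCert{Fcc,Hcp}` +
soundness `…StubLabelledPlacement{Tree,Leaf}`), with exactly the text registered on both cruxes — it is IMPORTED here, so
`stub_chartCore`, `chart`, `chart3` and the coarse-regime milestone `NearFieldConvexity_coarse` (the crux for every η ≥ 2/5) are now
UNCONDITIONAL theorems (the latter is landed as `stub_nearFieldConvexityCoarse`).  On the energy side, wave-2 worker W2 landed the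
CHEBYSHEV REDUCTION of (I_band) (`stub_perturbativeOfThreshold`, p170995, with the layered-threshold toolkit p170796 and
`stub_thresholdOfFlat` p170998): (I_band) follows from the new registered stub `stub_thresholdSqPaid` — "the summed squared
layeredness threshold θ(i) = sInf{e ≥ 0 | 2-ball e-layered} over the radius-8 interior of an ε₁-good set is paid linearly by the
excess", ∃ ε₁ ∈ [1/100, 1/20].  Sorries: `stub_thresholdSqPaid` (I_sq), `stub_roughSitesPaid` (II_band).

v21 (lead c4): TWO SEAMS CUT.  (a) Geometry: `stub_labelledPlacement` is DERIVED from the new registered residual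
`stub_labelledPlacementContext` ("the 18 pivots are labelled by ONE genuine letter context κ of the √18 integer
model": the exact interface agreed with the wave-1 worker, whose CSP pieces P-A…P-D end in it) by the landed
`stub_labelledPlacementOfContext` (p167097; template realisation `stub_labelledPlacementTemplate` p166136).
(b) Energy: the summed interior coercivity is SPLIT BY REGIME (analysis A4 of the line card) into
`stub_perturbativeCoercivity` ((I): ∃ ε₁ ∈ [1/100, 1/20] — a BAND above the c/a anisotropy of relaxed hcp, since an
ideal-pattern selector at every ε is false — coercivity on ε₁-good sets — the perturbative Ortner–Theil regime,
fed by UniformPolytypeStability stmt-15800) and `stub_roughSitesPaid` ((II): ∀ ε₁, the 1/20-good-but-not-ε₁-good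
sites are paid linearly by the excess — the non-perturbative part), composed by `interiorCoercivity_of_bandSplit`
(proved below; the unbanded `interiorCoercivity_of_split` is landed, p167075) + `stub_pnfOfInteriorCoercivityEStar` (p167075; `e*`-form: a prover compares with
any periodic reference since `e(Q) ≥ e*`).  Sorries: `stub_labelledPlacementContext`, `stub_perturbativeCoercivity`,
`stub_roughSitesPaid`.

v20 (lead c4): the ENERGY STUB GOES SUMMED.  `stub_certificateOnChartsRef` (pointwise calibrated inequality with an
antisymmetric `r⁻⁶`-dominated transfer `τ` at radius-8 interior sites) is replaced by `stub_interiorCoercivity` — the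
same content in the form every cluster-functional certificate proves directly and all the downstream bookkeeping ever
used: `∃ Q` periodic, `∀ δ η ∃ c > 0, C`: for `δ`-separated `x` and good `Ω` with `2/5`-charts at its radius-3 interior
sites, `c·#{i ∈ int₈Ω : B(x i,2) not η-layered} ≤ [E_self(Ω) − |Ω|·e(Q)] + C·#∂₄Ω`.  PNF follows by the LANDED
`stub_pnfOfInteriorCoercivity` (`e* ≤ e(Q)`, `#NL ≤ #NL(int₈) + #B₈`, collar-8 count + pair count); the transfer `τ`, its
flux envelope and the sitewise floor leave the obligation (pointwise ⇒ summed is `lc_bookkeeping`; summed ⇒ pointwise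
would be Hoffman circulation, never needed).  Charts at radius 3 come from `chart_of_stubs_radius` (landed) on
`stub_chartCore`.  Sorries: `stub_labelledPlacement`, `stub_interiorCoercivity`.

v19 (lead c4): the chart assembly, the interface lemma and the small helpers now live in the tree
(`Theorems/…CoarseRegime.lean`, p164216: `chart_of_stubs_radius`, `interfaceLemma`, `chart_template_eq`,
`sqrt_six_div_three_mem`, `layered_of_chart`, `stub_coarseRegime`) and are imported; NEW derived milestone
`NearFieldConvexity_coarse` — the crux for every `η ≥ 2/5` modulo ONLY `stub_labelledPlacement` (no energy certificate).
Landed certificate bricks (p163665 `…CertificateAlgebra`: D7 transfer bookkeeping, D4 self-stress expansion; p163860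
`…LjSquared`: Bregman convexity of `V_LJ` in the squared distance on the good tube) are in the tree for the future proof of N2345′
(not imported here: nothing below uses them yet).

v18 (lead c4, 2026-08-17): `stub_chartCore` (shared VERBATIM with the twin crux stmt-16827 `NashNearField`) is DERIVED
from the new registered stub `stub_labelledPlacement` by the twin's LANDED assembly
`NashClassCertificatesNashNearField.stub_chartCore_of_labelled_placement` (p161895; bridge (i)+(ii) p161059, label lemmas
p162207): the residual is the per-pivot adjacent injective site labelling, metrically `2/5`-accurate where needed — the
same registered text as the twin's `stub_labelledPlacement` (skeleton v4 of line `birth`), so ONE proof closes the chart for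
both cruxes.  Sorries: `stub_labelledPlacement`, `stub_certificateOnChartsRef`.

v15 (lead c3, 2026-08-17): the chart stub N1 is RESHAPED by certified constants and cut into three registered
geometric pieces with a PROVED assembly (`chart_of_stubs`):
* `stub_chartCoverage` (S1, M) — the 2-ball around a good particle is covered by the `3a/2`-balls of its 18
  pattern neighbours: `∀ ‖y‖ ≤ 2, ∃ v ∈ {0} ∪ P, ‖y − a•A v‖ ≤ 141/100 − a/20` (worst direction = a
  tetrahedral-hole direction, `√(4 + a² − 2a·2√(2/3)) ≤ 1.41 − a/20` on `[47/50, 1]`, margin 0.016);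
* `stub_chartSites` (S3, M) — every site of an ideal Barlow template (`barlowPos 1 (√6/3) s`) within `43/20`
  of a site is that site or within `3/2` of one of its 18 central neighbours (exact enumeration: the first shell
  that fails is `√6`);
* `stub_chartCore` (S2, L) — THE CORE: at a particle whose 3-ball is 1/20-good, the witnessed two-shell patterns
  of its 18 neighbours glue to ONE ideal Barlow template through the centre's own pattern (robust pair lemma with
  exact label identification, metric-free constraint satisfaction over the finitely many exact relative
  placements — 4 resp. 13 solutions = the genuine letter contexts —, then ℓ¹-affine placement bounds ≤ 0.3585·a),
  stated without new definitions as `∃ (R : isometry) (s : Hägg word)` + two compatibility and two matching clauses.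
`chart := chart_of_stubs stub_chartCoverage stub_chartCore stub_chartSites` is N1 with tolerance `2/5`
(the honest constant; 3/10 misses by 0.0085 with crude chaining), scale window `[47/50, 1]`, spacing window
`[39a/50, 17a/20]` (ideal `h = a√6/3`).  N2345′ (`stub_certificateOnChartsRef`) is re-registered with the new chart
as hypothesis.  Sorries: `stub_chartCore`, `stub_certificateOnChartsRef` (v16: `stub_chartSites` LANDED p148923; v17: `stub_chartCoverage` LANDED p150430; both imported).

v13 (lead c2, design step D1): `e*` ELIMINATED from the certificate obligation — `stub_certificateOnCharts` is derived
(`certificateOnCharts_of_ref`, proved) from `stub_certificateOnChartsRef`, the same pointwise inequality measured against the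
energy per particle of one periodic configuration exhibited by the prover.
v8–v12: every other stub of the line is LANDED and imported: interface chain p106669 p106682 p112085 p106696,
crux ⟸ IL + PNF p107126, transfer p106657, PNF ⟸ LC bookkeeping p114798 p115024 p115421 p137952.
Composition: `NearFieldConvexity_of := stub_cruxOfPureNearField interfaceLemma stub_pureNearField`.
-/

noncomputable section

open scoped BigOperators
open Literature.MathematicalPhysics.StatisticalMechanics Literature.Geometry.DiscreteGeometry

namespace Summit.AtomisticToContinuum.Crystallization.Theorems.PhononSlackNearFieldConvexity

/-- **Stub (I_flat) `stub_flatnessPaid` (v23; the PERTURBATIVE REGIME in the twin crux's flatness vocabulary, size XL).**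
There is a goodness tolerance `ε₁ ∈ [1/100, 1/20]` such that for every `δ > 0` there are `K ≥ 0`, `C` with: for every `δ`-separated `x`
and every finite set `Ω` of `ε₁`-good particles one can choose, at each radius-8 interior site `i`, a Hägg word `s_i`, a continuous linear
`G_i` (bi-Lipschitz `4/5, 6/5`) and `ν_i ≥ 0` such that the 3-ball of `x i` is two-way `ν_i`-matched with `x i + G_i(barlowPos 1 (√6/3) s_i)`
(the twin's B″ flatness clauses verbatim), together with a linear isometry `A_i` and a box cell `(a_i, h_i)` whose scaled template is
`r_i`-close to `G_i` on the unit sites of norm ≤ 3, with `Σ_{i ∈ int₈Ω} (2400 ν_i² + 800 r_i²) ≤ K·[E_self(Ω) − |Ω|·e*] + C·#∂₄Ω`.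
NATURAL CUT (not registered; composes with no smallness condition in this K-format): (I_ν) `Σ ν_i² ≤ K₁·ex + C₁∂` for the best affine
fits (non-affine / optical harmonic stability of force-balanced Barlow clusters — input of the `UniformPolytypeStability` type, stmt-15800)
and (I_r) `∀ flatness witnesses, ∃ cells: Σ min(r_i, 1/10)² ≤ K₂·ex + C_R Σν_i² + C₂∂` (Cauchy–Born landscape coercivity in the tube with
cross terms — the twin's B″ technique in summed form; its landed pieces `…StubCauchyBornBarlowCoercivity*`, `…StubTubeCoercivity`,
`…StubSmoothRegimeCoercivity*`, `…StubTriLandscape*` are directly usable). -/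
theorem stub_flatnessPaid :
    ∃ ε₁ : ℝ, 1 / 100 ≤ ε₁ ∧ ε₁ ≤ 1 / 20 ∧ ∀ δ : ℝ, 0 < δ → ∃ K : ℝ, 0 ≤ K ∧ ∃ C : ℝ, ∀ (N : ℕ) (x : Fin N → EuclideanSpace ℝ (Fin 3)), (∀ i j : Fin N, i ≠ j → δ ≤ dist (x i) (x j)) → ∀ Ω : Finset (Fin N), (∀ i ∈ Ω, IsTwoShellGood ε₁ (47 / 50) 1 x i) → ∃ (sW : Fin N → ℤ → ℤ) (Gw : Fin N → (EuclideanSpace ℝ (Fin 3) →L[ℝ] EuclideanSpace ℝ (Fin 3))) (νw rw : Fin N → ℝ) (Aw : Fin N → (EuclideanSpace ℝ (Fin 3) →ₗᵢ[ℝ] EuclideanSpace ℝ (Fin 3))) (aw hw : Fin N → ℝ), (∀ i ∈ Ω, (∀ k : Fin N, dist (x k) (x i) ≤ 8 → k ∈ Ω) → IsHaggSeq (sW i) ∧ 0 ≤ νw i ∧ ((∀ j : Fin N, dist (x j) (x i) ≤ 3 → ∃ m u v : ℤ, dist (x j - x i) ((Gw i) (barlowPos 1 (Real.sqrt 6 /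 3) (sW i) m u v)) ≤ (νw i)) ∧ (∀ m u v : ℤ, ‖(Gw i) (barlowPos 1 (Real.sqrt 6 / 3) (sW i) m u v)‖ ≤ 3 → ∃ j : Fin N, dist (x j - x i) ((Gw i) (barlowPos 1 (Real.sqrt 6 / 3) (sW i) m u v)) ≤ (νw i)) ∧ (∀ p : EuclideanSpace ℝ (Fin 3), 4 / 5 * ‖p‖ ≤ ‖(Gw i) p‖ ∧ ‖(Gw i) p‖ ≤ 6 / 5 * ‖p‖)) ∧ 47 / 50 ≤ aw i ∧ aw i ≤ 1 ∧ 39 / 50 * aw i ≤ hw i ∧ hw i ≤ 17 / 20 * aw i ∧ (∀ m u v : ℤ, ‖barlowPos 1 (Real.sqrt 6 / 3) (sW i) m u v‖ ≤ 3 → dist ((Gw i) (barlowPos 1 (Real.sqrt 6 / 3) (sW i) m u v)) ((Aw i) (barlowPos (aw i) (hw i) (sW i) m u v)) < rw i)) ∧ (∑ i ∈ Ω.filter (fun i => ∀ k : Fin N, dist (x k) (x i) ≤ 8 → k ∈ Ω), (2400 * (νw i) ^ 2 + 800 * (rw i) ^ 2)) ≤ K * ((∑ i ∈ Ω, (1 /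 2 : ℝ) * (∑ j ∈ Ω.erase i, lennardJones (dist (x i) (x j)))) - (Ω.card : ℝ) * (⨅ Q : PeriodicConfiguration 3, Q.energyPerParticle lennardJones)) + C * (Nat.card {i : Fin N // i ∈ Ω ∧ ∃ j : Fin N, j ∉ Ω ∧ dist (x j) (x i) ≤ 4} : ℝ) := by
  sorry

/-- **Stub (II) `stub_roughSitesPaid` (v21; the NON-PERTURBATIVE REGIME, size XL).**  For EVERY `ε₁ ∈ [1/100, 1/20]` (BAND, see (I)) and `δ > 0`
there are `K ≥ 0`, `C` with: for every `δ`-separated `x` and every set `Ω` of `1/20`-good particles (with `2/5`-charts at its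
radius-3 interior sites), `#{i ∈ Ω : ¬ ε₁-good} ≤ K·[E_self(Ω) − |Ω|·e*] + C·#∂₄Ω` — particles of the 5 % tube that are not even
`ε₁`-good cost a definite amount each ("no cheap rough sites"; analysis A4: basin of the relaxed polytypes in the 1/20 tube;
certified robust germ / tube numerics j020058, j026419, j026422; on the Nash class this is where the twin crux's lever A″ acts). -/
theorem stub_roughSitesPaid :
    ∀ ε₁ : ℝ, 1 / 100 ≤ ε₁ → ε₁ ≤ 1 / 20 → ∀ δ : ℝ, 0 < δ → ∃ K : ℝ, 0 ≤ K ∧ ∃ C : ℝ, ∀ (N : ℕ) (x : Fin N → EuclideanSpace ℝ (Fin 3)), (∀ i j : Fin N, i ≠ j → δ ≤ dist (x i) (x j)) → ∀ Ω : Finset (Fin N), (∀ i ∈ Ω, IsTwoShellGood (1 / 20) (47 / 50) 1 x i) → (∀ i ∈ Ω, (∀ k : Fin N, dist (x k) (x i) ≤ 3 → k ∈ Ω) → (∃ (A : EuclideanSpace ℝ (Fin 3) →ₗᵢ[ℝ] EuclideanSpace ℝ (Fin 3)) (a h : ℝ) (s : ℤ → ℤ), 47 / 50 ≤ a ∧ a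 ≤ 1 ∧ 39 / 50 * a ≤ h ∧ h ≤ 17 / 20 * a ∧ IsHaggSeq s ∧ (fun S : Set (EuclideanSpace ℝ (Fin 3)) => (∀ j : Fin N, dist (x j) (x i) ≤ 2 → ∃ p ∈ S, dist (x j) p ≤ 2 / 5) ∧ (∀ p ∈ S, dist p (x i) ≤ 2 → ∃ j : Fin N, dist (x j) p ≤ 2 / 5)) {p | ∃ m u v : ℤ, p = x i + A (((u : ℝ) • triangularVec₁ a) + ((v : ℝ) • triangularVec₂ a) + ((haggLabel s m : ℝ) • barlowOffset a) + ((m : ℝ) • layerNormal h))})) → (Nat.card {i : Fin N // i ∈ Ω ∧ ¬ IsTwoShellGood ε₁ (47 / 50) 1 x i} : ℝ) ≤ K * ((∑ i ∈ Ω, (1 / 2 : ℝ) * (∑ j ∈ Ω.erase i, lennardJones (dist (x i) (x j)))) - (Ω.card : ℝ) * (⨅ Q : PeriodicConfiguration 3, Q.energyPerParticle lennardJones)) + C * (Nat.card {i : Fin N // i ∈ Ω ∧ ∃ j : Fin N, j ∉ Ω ∧ dist (x j) (x i) ≤ 4} : ℝ) := by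
  sorry

end Summit.AtomisticToContinuum.Crystallization.Theorems.PhononSlackNearFieldConvexity

namespace Summit.AtomisticToContinuum.Crystallization.Theorems

open PhononSlackNearFieldConvexity in
/-- **The composition of line `Sketch`: the crux `NearFieldConvexity` by name, modulo the two registered stubs** (v24: the
landed energy-split assembly p172837). -/
theorem NearFieldConvexity_of :
    Summit.AtomisticToContinuum.Crystallization.Theses.PhononSlackCertificates.NearFieldConvexity :=
  nearFieldConvexity_of_energySplit stub_flatnessPaid stub_roughSitesPaid

end Summit.AtomisticToContinuum.Crystallization.Theorems
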